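import Summits.BirchSwinnertonDyer.BirchSwinnertonDyer.Theorems.AlignedTransportAtTwoMainConjectureOfRankZeroBSDAtTwoSelmerLayerBudget
import Mathlib.RingTheory.Polynomial.GaussLemma
import Mathlib.RingTheory.AdjoinRoot
import Mathlib.LinearAlgebra.Dimension.Localization
import HarnessLib

/-!
# Route `AlignedTransportAtTwo`, crux C2 `MainConjectureOfRankZeroBSDAtTwo` (stmt-BirchSwinnertonDyer-22298):
# THE SHAPE OF A SELMER JUMP — `rank_{ℤ_p} X/Ψ_{n+1}X = φ(p^{n+1})·t` with `Ψ_{n+1}^t ∣ char_Λ X`; hence, modulo Greenberg's `ker g`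
# at the two layers, the `p^∞`-Selmer corank jumps from `K_n` to `K_{n+1}` by a MULTIPLE `φ(p^{n+1})·t` of `φ(p^{n+1})` and
# `Ψ_{n+1}^t ∣ f_X` (the Ш-inclusive twin of the lineage's `…CyclotomicLayerRankJumpExact`)

HONEST FRAMING (cell `bsd-f1-sign2`, WIDTH-5 attached prover seat `bsd-line-att-p5` gen 40 on line `birth` of the lead
`bsd-line-att-p2`; `--supports` stmt-BirchSwinnertonDyer-22298, closes nothing; BSD is NOT proved by any of this; the crux
C2, its verdict «blocked-on `Rank1Residual.GreenbergMuConjectureIrreducible`» and every registered stub are untouched).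
THEOREMS ONLY — no `def`, no instance, no named fact, no `sorry`. Pure `Λ`-algebra first, then the Selmer reading through
`…SelmerLayerSplit` / `…SelmerLayerBudget`:

* §1 `aeval_smulEnd_apply` (`Q(g) m = Q·m` for `g = T·` on a `Λ`-module), ★★ `natDegree_dvd_lambdaInvariant_of_coe_smul_eq_zero` —
  **`deg P ∣ rank_{ℤ_p} M` for a `Λ`-module `M` killed by a monic `P ∈ ℤ_p[X]` irreducible over `ℚ_p`** (`ℚ_p ⊗ M` is a vector space
  over the field `ℚ_p[X]/(P)`; the `ℤ_p/ℚ_p` twin of g36's `natDegree_dvd_finrank_of_aeval_eq_zero`); ★★ `totient_dvd_lambdaInvariant_cyclotomicFactor`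
  — **`φ(p^{n+1}) ∣ rank_{ℤ_p} X/Ψ_{n+1}X`** (`Ψ_{n+1}` is prime in `ℤ_p[X]`, cell `bsd-ssimc`'s `DefectPrime.prime_cyclotomic_comp_polynomial`, hence
  irreducible over `ℚ_p` by Gauss).
* §2 ★★ `coe_pow_dvd_of_mem_charIdeal_of_mul_le_lambdaInvariant` — **`P^t ∣ g ∈ char_Λ X` whenever `deg P · t ≤ rank_{ℤ_p} X/PX`** (`P`
  distinguished and prime in `Λ`, `X` f.g. torsion): `rank` many `ℤ_p`-independent elements of `X/PX` lifted to `X` feed g36's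
  `coe_pow_dvd_of_mem_charIdeal_of_indep`; ★★ `cyclotomicLayer_pow_dvd_of_mem_charIdeal_of_mul_le_lambdaInvariant`.
* §3 (Selmer, any number field / `ℤ_p`-extension; `W` elliptic) ★★★ `totient_dvd_selmerCorank_layer_succ_sub_of_finite_kerG` —
  **`φ(p^{n+1}) ∣ corank Sel_{p^∞}(E_{K_{n+1}}/K_{n+1}) − corank Sel_{p^∞}(E_{K_n}/K_n)`** mod `ker g_n`, `ker g_{n+1}` finite;
  ★★★ `cyclotomicLayer_pow_dvd_of_mem_charIdeal_of_mul_le_selmerCorank_sub_of_finite_kerG` — **`Ψ_{n+1}^t ∣ char_Λ X` whenever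
  `φ(p^{n+1})·t ≤` the Selmer-corank jump**; unconditional variant with `rank X/ω_nX` in place of `corank Sel(E_{K_n})`.

References: R. Greenberg, LNM 1716 (1999), §5 p. 132 («`E(F_n) ⊗ ℚ_p ≅ ρ^t`», «`θ_1^t` divides `f_E(T)`»), Thm. 1.2 [GreenbergLNM1716];
L. Washington, GTM 83, §13.2 [Washington1997].
-/

set_option linter.dupNamespace false
set_option autoImplicit false

noncomputable section

open scoped Classical AddSubgroup TensorProduct Polynomial

universe u

namespace Summit.BirchSwinnertonDyer.BirchSwinnertonDyer.Theorems.AlignedTransportAtTwoSelmerLayerJumpShape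

open Polynomial WeierstrassCurve Literature.NumberTheory.EllipticCurves Literature.NumberTheory.EllipticCurves.IwasawaDual
  Summit.BirchSwinnertonDyer.BirchSwinnertonDyer.Theorems.AlignedTransportAtTwoSelmerLayerModel
  Summit.BirchSwinnertonDyer.BirchSwinnertonDyer.Theorems.AlignedTransportAtTwoSelmerLayerDuality
  Summit.BirchSwinnertonDyer.BirchSwinnertonDyer.Theorems.AlignedTransportAtTwoSelmerLayerControl
  Summit.BirchSwinnertonDyer.BirchSwinnertonDyer.Theorems.AlignedTransportAtTwoSelmerLayerSplit
  Summit.BirchSwinnertonDyer.BirchSwinnertonDyer.Theorems.AlignedTransportAtTwoSelmerLayerGrowthDichotomy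
  Summit.BirchSwinnertonDyer.BirchSwinnertonDyer.Theorems.AlignedTransportAtTwoSelmerLayerBudget
  Summit.BirchSwinnertonDyer.BirchSwinnertonDyer.Theorems.AlignedTransportAtTwoCyclotomicLayerPrime

/-! ## §1 `deg P ∣ rank_{ℤ_p} M` when `P · M = 0` -/

section Algebra

variable (p : ℕ) [hp : Fact p.Prime]

/-- **`Q(g) m = Q · m`** for a `ℤ_p`-linear endomorphism `g` acting as `T ·` on a `Λ`-module with a compatible `ℤ_p`-structure, and every
`Q ∈ ℤ_p[X]` (induction on `Q`). [folklore] -/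
theorem aeval_smulEnd_apply (M : Type*) [AddCommGroup M] [Module (IwasawaAlgebra p) M] [Module ℤ_[p] M]
    [IsScalarTower ℤ_[p] (IwasawaAlgebra p) M] (g : Module.End ℤ_[p] M)
    (hg : ∀ m : M, g m = (PowerSeries.X : IwasawaAlgebra p) • m) (Q : ℤ_[p][X]) (m : M) :
    Polynomial.aeval g Q m = (Q : PowerSeries ℤ_[p]) • m := by
  induction Q using Polynomial.induction_on generalizing m with
  | C a =>
    rw [Polynomial.aeval_C, Module.algebraMap_end_apply, Polynomial.coe_C, ← algebraMap_smul (IwasawaAlgebra p) a m]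
    rfl
  | add P Q hP hQ => rw [map_add, LinearMap.add_apply, hP, hQ, Polynomial.coe_add, add_smul]
  | monomial k a ih =>
    rw [pow_succ, ← mul_assoc, map_mul, Polynomial.aeval_X, Module.End.mul_apply, hg, ih,
      Polynomial.coe_mul (Polynomial.C a * Polynomial.X ^ k) Polynomial.X, Polynomial.coe_X, mul_smul]

/-- ★★ **`deg P ∣ rank_{ℤ_p} M`** (`rank_{ℤ_p} = dim_{ℚ_p} ℚ_p ⊗`, the tree's `lambdaInvariant`) for a `Λ`-module `M` killed by the image of a
monic `P ∈ ℤ_p[X]` that is irreducible over `ℚ_p`: `V = ℚ_p ⊗_{ℤ_p} M` is a vector space over the FIELD `ℚ_p[X]/(P)` acting through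
`T`, so `dim_{ℚ_p} V = deg P · dim_{ℚ_p[X]/(P)} V`. (The `ℤ_p` twin of g36's `natDegree_dvd_finrank_of_aeval_eq_zero`; Greenberg's
«`⊗ ℚ_p ≅ ρ^t`», p. 132.) [cite: GreenbergLNM1716, §5 p. 132] -/
theorem natDegree_dvd_lambdaInvariant_of_coe_smul_eq_zero (M : Type*) [AddCommGroup M] [Module (IwasawaAlgebra p) M]
    {P : ℤ_[p][X]} (hP : P.Monic) (hirr : Irreducible (P.map (algebraMap ℤ_[p] ℚ_[p])))
    (hM : ∀ m : M, (P : PowerSeries ℤ_[p]) • m = 0) : P.natDegree ∣ lambdaInvariant p M := by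
  letI : Module ℤ_[p] M := Module.compHom M (algebraMap ℤ_[p] (IwasawaAlgebra p))
  haveI : IsScalarTower ℤ_[p] (IwasawaAlgebra p) M := IsScalarTower.of_compHom _ _ _
  set Pq : ℚ_[p][X] := P.map (algebraMap ℤ_[p] ℚ_[p]) with hPq
  -- `g = T·` as a `ℤ_p`-linear endomorphism, `P(g) = 0`
  let g : Module.End ℤ_[p] M := (LinearMap.lsmul (IwasawaAlgebra p) M (PowerSeries.X : IwasawaAlgebra p)).restrictScalars ℤ_[p]
  have hgP : Polynomial.aeval g P = 0 := by
    refine LinearMap.ext fun m ↦ ?_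
    rw [aeval_smulEnd_apply p M g (fun _ ↦ rfl), LinearMap.zero_apply]
    exact hM _
  -- base change `V = ℚ_p ⊗ M`
  let gV : Module.End ℚ_[p] (ℚ_[p] ⊗[ℤ_[p]] M) := g.baseChange ℚ_[p]
  have hgV' : Polynomial.aeval gV P = 0 := by
    have h := Polynomial.aeval_algHom_apply (Module.End.baseChangeHom ℤ_[p] ℚ_[p] M) g P
    rw [hgP, map_zero] at h
    exact h
  have hgV : Polynomial.aeval gV Pq = 0 := by
    rw [hPq, Polynomial.aeval_map_algebraMap]
    exact hgV'
  -- `K = ℚ_p[X]/(P)` is a field of degree `deg P`, acting on `V` through `gV`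
  haveI : Fact (Irreducible Pq) := ⟨hirr⟩
  have hPq0 : Pq ≠ 0 := hirr.ne_zero
  let φ : AdjoinRoot Pq →ₐ[ℚ_[p]] Module.End ℚ_[p] (ℚ_[p] ⊗[ℤ_[p]] M) :=
    Ideal.Quotient.liftₐ (Ideal.span {Pq}) (Polynomial.aeval gV) (by
      intro a ha
      obtain ⟨b, rfl⟩ := Ideal.mem_span_singleton'.mp ha
      rw [map_mul, hgV, mul_zero])
  letI : Module (AdjoinRoot Pq) (ℚ_[p] ⊗[ℤ_[p]] M) :=
    Module.compHom (ℚ_[p] ⊗[ℤ_[p]] M) (φ : AdjoinRoot Pq →+* Module.End ℚ_[p] (ℚ_[p] ⊗[ℤ_[p]] M))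
  haveI : IsScalarTower ℚ_[p] (AdjoinRoot Pq) (ℚ_[p] ⊗[ℤ_[p]] M) := by
    refine ⟨fun q k v ↦ ?_⟩
    change φ (q • k) v = q • φ k v
    rw [map_smul]
    rfl
  have hK : Module.finrank ℚ_[p] (AdjoinRoot Pq) = P.natDegree := by
    rw [(AdjoinRoot.powerBasis hPq0).finrank, AdjoinRoot.powerBasis_dim, hPq, hP.natDegree_map]
  have htower := Module.finrank_mul_finrank ℚ_[p] (AdjoinRoot Pq) (ℚ_[p] ⊗[ℤ_[p]] M)
  refine ⟨Module.finrank (AdjoinRoot Pq) (ℚ_[p] ⊗[ℤ_[p]] M), ?_⟩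
  change Module.finrank ℚ_[p] (ℚ_[p] ⊗[ℤ_[p]] M) = _
  rw [← htower, hK]

/-- ★★ **`φ(p^{n+1}) ∣ rank_{ℤ_p} X/Ψ_{n+1}X`** for every `Λ`-module `X` (`Ψ_{n+1} = Φ_{p^{n+1}}(1+T) = ∑_{i<p}((1+T)^{pⁿ})^i` is monic of
degree `φ(p^{n+1}) = pⁿ(p−1)`, prime in `ℤ_p[X]` (cell `bsd-ssimc`, `DefectPrime.prime_cyclotomic_comp_polynomial`), hence irreducible over
`ℚ_p` by Gauss's lemma). [cite: GreenbergLNM1716, §5 p. 132] [cite: Washington1997, §13.2] -/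
theorem totient_dvd_lambdaInvariant_cyclotomicFactor (X : Type*) [AddCommGroup X] [Module (IwasawaAlgebra p) X] (n : ℕ) :
    p ^ n * (p - 1) ∣ lambdaInvariant p (X ⧸ (Ideal.span
      {(∑ i ∈ Finset.range p, ((1 + PowerSeries.X : PowerSeries ℤ_[p]) ^ (p ^ n)) ^ i : IwasawaAlgebra p)} •
        ⊤ : Submodule (IwasawaAlgebra p) X)) := by
  have hmonic : ((cyclotomic (p ^ (n + 1)) ℤ_[p]).comp (Polynomial.X + 1)).Monic := DefectPrime.monic_cyclotomic_comp _
  have hprime := DefectPrime.prime_cyclotomic_comp_polynomial p n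
  have hirr : Irreducible (((cyclotomic (p ^ (n + 1)) ℤ_[p]).comp (Polynomial.X + 1)).map (algebraMap ℤ_[p] ℚ_[p])) :=
    (hmonic.irreducible_iff_irreducible_map_fraction_map).mp hprime.irreducible
  rw [← natDegree_cyclotomicLayer p n]
  refine natDegree_dvd_lambdaInvariant_of_coe_smul_eq_zero p _ hmonic hirr fun q ↦ ?_
  induction q using Submodule.Quotient.induction_on with
  | H x =>
    rw [← Submodule.Quotient.mk_smul, Submodule.Quotient.mk_eq_zero, coe_cyclotomicLayer_eq_sum]
    exact Submodule.smul_mem_smul (Ideal.mem_span_singleton_self _) Submodule.mem_top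

end Algebra

/-! ## §2 `P^t ∣ char_Λ X` from `deg P · t ≤ rank_{ℤ_p} X/PX` -/

section Multiplicity

variable (p : ℕ) [hp : Fact p.Prime]

/-- ★★ **`P^t ∣ g` for every `g ∈ char_Λ X` whenever `deg P · t ≤ rank_{ℤ_p} X/PX`** (`P ∈ ℤ_p[X]` distinguished and prime in `Λ`, `X` a
finitely generated torsion `Λ`-module): `rank_{ℤ_p} X/PX` elements of `X/PX` independent over `ℤ_p` exist (`X/PX` is `ℤ_p`-finite,
`exists_set_linearIndependent`), their lifts to `X` are independent modulo `P·X`, and g36's `coe_pow_dvd_of_mem_charIdeal_of_indep`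
(rank conversion + lengths at `(P)`) concludes. With §1 this reads: `rank X/PX = deg P · t_P` and `P^{t_P} ∣ f_X`.
[cite: Washington1997, §13.2] [cite: GreenbergLNM1716, §5 p. 132] -/
theorem coe_pow_dvd_of_mem_charIdeal_of_mul_le_lambdaInvariant {P : ℤ_[p][X]}
    (hP : P.IsDistinguishedAt (IsLocalRing.maximalIdeal ℤ_[p])) (hPr : Prime (P : PowerSeries ℤ_[p]))
    (X : Type u) [AddCommGroup X] [Module (IwasawaAlgebra p) X] [Module.Finite (IwasawaAlgebra p) X]
    (hX : Module.IsTorsion (IwasawaAlgebra p) X) {t : ℕ}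
    (ht : P.natDegree * t ≤ lambdaInvariant p (X ⧸ (Ideal.span {(P : PowerSeries ℤ_[p])} • ⊤ : Submodule (IwasawaAlgebra p) X)))
    {g : IwasawaAlgebra p} (hg : g ∈ Module.charIdeal (IwasawaAlgebra p) X) : (P : PowerSeries ℤ_[p]) ^ t ∣ g := by
  -- the `ℤ_p`-module `Q = X/PX`
  letI : Module ℤ_[p] (X ⧸ (Ideal.span {(P : PowerSeries ℤ_[p])} • ⊤ : Submodule (IwasawaAlgebra p) X)) :=
    Module.compHom _ (algebraMap ℤ_[p] (IwasawaAlgebra p))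
  haveI hfin : Module.Finite ℤ_[p] (X ⧸ (Ideal.span {(P : PowerSeries ℤ_[p])} • ⊤ : Submodule (IwasawaAlgebra p) X)) :=
    module_finite_int_quotient p (Ideal.span {(P : PowerSeries ℤ_[p])}) (free_finite_finrank_quotient_coe hP).2.1
  have hrank : lambdaInvariant p (X ⧸ (Ideal.span {(P : PowerSeries ℤ_[p])} • ⊤ : Submodule (IwasawaAlgebra p) X)) =
      Module.finrank ℤ_[p] (X ⧸ (Ideal.span {(P : PowerSeries ℤ_[p])} • ⊤ : Submodule (IwasawaAlgebra p) X)) :=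
    (TensorProduct.isBaseChange ℤ_[p] (X ⧸ (Ideal.span {(P : PowerSeries ℤ_[p])} • ⊤ : Submodule (IwasawaAlgebra p) X))
      ℚ_[p]).finrank_eq
  set m := Module.finrank ℤ_[p] (X ⧸ (Ideal.span {(P : PowerSeries ℤ_[p])} • ⊤ : Submodule (IwasawaAlgebra p) X)) with hm
  -- `m` independent elements of `Q`
  obtain ⟨s, hs, hli⟩ := exists_set_linearIndependent ℤ_[p]
    (X ⧸ (Ideal.span {(P : PowerSeries ℤ_[p])} • ⊤ : Submodule (IwasawaAlgebra p) X))
  have hsm : Cardinal.mk s = m := by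
    rw [hs, hm, Module.finrank, Cardinal.cast_toNat_of_lt_aleph0 (Module.rank_lt_aleph0 ℤ_[p] _)]
  obtain ⟨e⟩ := Cardinal.mk_eq_nat_iff.mp hsm
  let v : Fin m → (X ⧸ (Ideal.span {(P : PowerSeries ℤ_[p])} • ⊤ : Submodule (IwasawaAlgebra p) X)) := fun i ↦ (e.symm i : _)
  have hv : LinearIndependent ℤ_[p] v := hli.comp e.symm e.symm.injective
  -- lifts to `X`, independent modulo `P·X`
  choose x hx using fun i ↦ Submodule.Quotient.mk_surjective (Ideal.span {(P : PowerSeries ℤ_[p])} • ⊤ : Submodule (IwasawaAlgebra p) X) (v i)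
  have hindep : ∀ (c : Fin m → ℤ_[p]) (y : X),
      ∑ k, (PowerSeries.C (c k) : IwasawaAlgebra p) • x k = (P : PowerSeries ℤ_[p]) • y → ∀ k, c k = 0 := by
    intro c y hcy
    have h0 : ∑ k, c k • v k = 0 := by
      have h1 := congrArg (Submodule.mkQ (Ideal.span {(P : PowerSeries ℤ_[p])} • ⊤ : Submodule (IwasawaAlgebra p) X)) hcy
      rw [map_sum] at h1
      have h2 : Submodule.mkQ (Ideal.span {(P : PowerSeries ℤ_[p])} • ⊤ : Submodule (IwasawaAlgebra p) X)
          ((P : PowerSeries ℤ_[p]) • y) = 0 :=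
        (Submodule.Quotient.mk_eq_zero _).mpr (Submodule.smul_mem_smul (Ideal.mem_span_singleton_self _) Submodule.mem_top)
      rw [h2] at h1
      rw [← h1]
      refine Finset.sum_congr rfl fun k _ ↦ ?_
      rw [map_smul, Submodule.mkQ_apply, hx]
      rfl
    exact fun k ↦ Fintype.linearIndependent_iff.mp hv c h0 k
  exact coe_pow_dvd_of_mem_charIdeal_of_indep hP hPr X hX x hindep (by rw [← hrank]; exact ht) hg

/-- ★★ **`Ψ_{n+1}^t ∣ g ∈ char_Λ X` whenever `φ(p^{n+1})·t ≤ rank_{ℤ_p} X/Ψ_{n+1}X`** (`X` f.g. torsion). [cite: GreenbergLNM1716, §5 p. 132] -/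
theorem cyclotomicLayer_pow_dvd_of_mem_charIdeal_of_mul_le_lambdaInvariant (X : Type u) [AddCommGroup X]
    [Module (IwasawaAlgebra p) X] [Module.Finite (IwasawaAlgebra p) X] (hX : Module.IsTorsion (IwasawaAlgebra p) X) (n : ℕ) {t : ℕ}
    (ht : p ^ n * (p - 1) * t ≤ lambdaInvariant p (X ⧸ (Ideal.span
      {(∑ i ∈ Finset.range p, ((1 + PowerSeries.X : PowerSeries ℤ_[p]) ^ (p ^ n)) ^ i : IwasawaAlgebra p)} •
        ⊤ : Submodule (IwasawaAlgebra p) X)))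
    {g : IwasawaAlgebra p} (hg : g ∈ Module.charIdeal (IwasawaAlgebra p) X) :
    (((cyclotomic (p ^ (n + 1)) ℤ_[p]).comp (Polynomial.X + 1) : ℤ_[p][X]) : PowerSeries ℤ_[p]) ^ t ∣ g := by
  refine coe_pow_dvd_of_mem_charIdeal_of_mul_le_lambdaInvariant p (DefectPrime.cyclotomic_comp_isDistinguishedAt_maximalIdeal p n)
    (DefectPrime.prime_coe_cyclotomic_comp p n) X hX ?_ hg
  rw [natDegree_cyclotomicLayer, coe_cyclotomicLayer_eq_sum]
  exact ht

end Multiplicity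

/-! ## §3 The shape of a Selmer jump -/

section Selmer

variable {K : Type u} [Field K] [NumberField K] (W : WeierstrassCurve K) [W.IsElliptic] {p : ℕ} [hp : Fact p.Prime]
  (κ : ZpExtension K p) {γ : Field.absoluteGaloisGroup K}

/-- ★★★ **`φ(p^{n+1})` divides the Selmer-corank jump**: `pⁿ(p−1) ∣ corank Sel_{p^∞}(E_{K_{n+1}}/K_{n+1}) − corank Sel_{p^∞}(E_{K_n}/K_n)` as soon
as `ker g_n`, `ker g_{n+1}` are finite (the jump IS `rank_{ℤ_p} X/Ψ_{n+1}X`, `…SelmerLayerSplit`; §1). The Ш-inclusive twin of the lineage's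
`totient_dvd_mordellWeilRank_layer_succ_sub`. [cite: GreenbergLNM1716, §5 p. 132, Thm 1.2] -/
theorem totient_dvd_selmerCorank_layer_succ_sub_of_finite_kerG (hγ : κ.IsTopGenerator γ) (D : W.SelmerDualData κ γ)
    [Module.Finite (IwasawaAlgebra p) D.X] (n : ℕ) [Finite (W.KerG κ n)] [Finite (W.KerG κ (n + 1))] :
    p ^ n * (p - 1) ∣ (W.baseChange (κ.layer (n + 1))).selmerCorank p - (W.baseChange (κ.layer n)).selmerCorank p := by
  rw [selmerCorank_layer_succ_eq_add_of_finite_kerG W κ hγ D n, add_tsub_cancel_left]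
  exact totient_dvd_lambdaInvariant_cyclotomicFactor p D.X n

/-- ★★★ **`Ψ_{n+1}^t ∣ char_Λ X` whenever `φ(p^{n+1})·t ≤` the Selmer-corank jump from `K_n` to `K_{n+1}`** (`X` torsion; `ker g_n`,
`ker g_{n+1}` finite). With the previous theorem: the jump is `φ(p^{n+1})·t` with `Ψ_{n+1}^t ∣ f_X` — Greenberg's p. 132 argument with
SELMER coranks (points or Ш). [cite: GreenbergLNM1716, §5 p. 132] -/
theorem cyclotomicLayer_pow_dvd_of_mem_charIdeal_of_mul_le_selmerCorank_sub_of_finite_kerG (hγ : κ.IsTopGenerator γ)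
    (D : W.SelmerDualData κ γ) [Module.Finite (IwasawaAlgebra p) D.X] (hD : D.IsTorsion) (n : ℕ) [Finite (W.KerG κ n)]
    [Finite (W.KerG κ (n + 1))] {t : ℕ}
    (ht : p ^ n * (p - 1) * t ≤ (W.baseChange (κ.layer (n + 1))).selmerCorank p - (W.baseChange (κ.layer n)).selmerCorank p)
    {g : IwasawaAlgebra p} (hg : g ∈ D.charIdeal) :
    (((cyclotomic (p ^ (n + 1)) ℤ_[p]).comp (Polynomial.X + 1) : ℤ_[p][X]) : PowerSeries ℤ_[p]) ^ t ∣ g := by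
  rw [selmerCorank_layer_succ_eq_add_of_finite_kerG W κ hγ D n, add_tsub_cancel_left] at ht
  exact cyclotomicLayer_pow_dvd_of_mem_charIdeal_of_mul_le_lambdaInvariant p D.X hD n ht hg

/-- ★★ **UNCONDITIONAL form**: `Ψ_{n+1}^t ∣ char_Λ X` whenever `φ(p^{n+1})·t ≤ corank Sel_{p^∞}(E_{K_{n+1}}/K_{n+1}) − rank_{ℤ_p} X/ω_nX`
(Lemma 3.1 at layer `n+1` only: `corank Sel(E_{K_{n+1}}) ≤ rank X/ω_nX + rank X/Ψ_{n+1}X`). [cite: GreenbergLNM1716, §3 Lemma 3.1, §5 p. 132] -/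
theorem cyclotomicLayer_pow_dvd_of_mem_charIdeal_of_mul_le_selmerCorank_sub_lambdaInvariant (hγ : κ.IsTopGenerator γ)
    (D : W.SelmerDualData κ γ) [Module.Finite (IwasawaAlgebra p) D.X] (hD : D.IsTorsion) (n : ℕ) {t : ℕ}
    (ht : p ^ n * (p - 1) * t ≤ (W.baseChange (κ.layer (n + 1))).selmerCorank p -
      lambdaInvariant p (D.X ⧸ (Ideal.span {((1 + PowerSeries.X : PowerSeries ℤ_[p]) ^ (p ^ n) - 1 : IwasawaAlgebra p)} •
        ⊤ : Submodule (IwasawaAlgebra p) D.X)))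
    {g : IwasawaAlgebra p} (hg : g ∈ D.charIdeal) :
    (((cyclotomic (p ^ (n + 1)) ℤ_[p]).comp (Polynomial.X + 1) : ℤ_[p][X]) : PowerSeries ℤ_[p]) ^ t ∣ g := by
  have h := selmerCorank_layer_succ_le W κ hγ D n
  exact cyclotomicLayer_pow_dvd_of_mem_charIdeal_of_mul_le_lambdaInvariant p D.X hD n (by omega) hg

end Selmer

end Summit.BirchSwinnertonDyer.BirchSwinnertonDyer.Theorems.AlignedTransportAtTwoSelmerLayerJumpShape

end
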